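import Mathlib.MeasureTheory.Measure.Hausdorff
import Mathlib.Topology.Order.IntermediateValue
import Literature.Analysis.FluidPDE.PartialRegularityHolds
import Literature.Analysis.FluidPDE.SuitableWeakProofs
import Literature.Analysis.FluidPDE.AxisymmetricVorticityTransport
import Literature.Analysis.FluidPDE.NSBoundedInteriorRegularity
import Literature.Analysis.FluidPDE.SereginSverakAxisymmetric
import HarnessLib

/-!
# Singular points of axisymmetric suitable weak solutions lie on the axis of symmetry

Analysis/FluidPDE proof file (theorems only; no definitions, no named facts) on the way to the
named fact `Literature.Analysis.FluidPDE.Seregin2020_axisymmetricSingularPoint_typeII`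
(`Seregin2020AxisymmetricTypeII.lean`; G. Seregin, *Local regularity of axisymmetric solutions to
the Navier–Stokes equations*, Anal. Math. Phys. 10 (2020), Paper 46 = arXiv:2006.04140,
Thm. 2.1). The printed proof of Thm. 2.1 opens (arXiv p. 5) with

> Denote by `S` the set of singular points of `v`. It is well known that `S` has 1D Hausdorff
> measure zero, `x' = 0` for any `z = (x, t) ∈ S`, and any spatial derivative of `v` is Hölder
> continuous in `𝒞 × ]-1, 0] ∖ S`,

and uses `x' = 0 on S` twice: in the Moser iteration for the swirl `σ = ϱ v_φ` (the cut-off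
`φ(x')` vanishing near the axis isolates `S`, (2.2)–(2.6)) and for the blow-up limit ("there
exists a closed set `S^Γ` … `x' = 0` for any `z = (x', x₃, t) ∈ S^Γ`", arXiv p. 7). The same
observation is the starting point of Seregin–Šverák 2009, §3 (arXiv:0804.1803, p. 9: "It is
well-known due to Caffarelli–Kohn–Nirenberg that if `z = (x, t)` is singular (i.e., not regular)
point of `v`, then there must be `x' = 0`. In other words, all singular points must belong to the
axis of symmetry") and of Seregin–Zajaczkowski 2007, §3.

This file PROVES it, for every suitable weak solution on an open space–time region with a CKN
force whose velocity slices are axisymmetric (pointwise, the tree's `IsAxisymmetric`), from the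
Caffarelli–Kohn–Nirenberg theorem `𝒫¹(S) = 0` (proved in the tree: `ckn_partial_regularity_holds`,
`PartialRegularityHolds.lean`) by the classical circle argument:

* `IsRegularPoint.rotZ_of_isAxisymmetric` — regularity (essential boundedness on a centred
  parabolic cylinder, `IsRegularPoint`) is transported along the rotations `R_θ` about the axis:
  the space–time rotation `(t, x) ↦ (t, R_{-θ} x)` preserves Lebesgue measure and maps
  `Q*_r(t₀, R_θ x₀)` onto `Q*_r(t₀, x₀)`, and `|u(t, x)| = |R_θ u(t, R_{-θ} x)| = |u(t, R_{-θ} x)|`;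
* `hausdorffMeasure_rotZ_arc_pos` — an arc `{(t₀, R_θ x₀) : |θ| < δ}` of the orbit of a point
  off the axis (`|x₀'| = ρ > 0`) has positive one-dimensional Hausdorff measure in `ℝ × ℝ³`: the
  `1`-Lipschitz functional `z ↦ (x₀₀ z₁ - x₀₁ z₀)/ρ` maps it onto `{ρ sin θ : |θ| < δ}`, which
  contains an interval of length `2ρ sin(min(δ, π/2)) > 0`;
* `cylRadius_eq_zero_of_mem_singularSet` — hence a singular point `z₀ = (t₀, x₀) ∈ Q` off the axis
  would carry a whole arc of singular points inside `Q` (openness of `Q`, continuity of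
  `θ ↦ R_θ x₀`), of positive `ℋ¹`-measure, whereas `𝒫¹(S) = 0` forces `ℋ¹(S) = 0`
  (`IsParabolicNull.hausdorffMeasure_eq_zero_holds`); so `x₀' = 0`;
* `isRegularPoint_of_cylRadius_ne_zero` — the contrapositive: every point of `Q` off the axis is
  regular;
* `SereginSverak2009.cylRadius_eq_zero_of_mem_singularSet_parCyl` — the case of the cylinders
  `Q(0, R) = 𝒞(R) × ]-R², 0[` of Seregin–Šverák 2009 / Seregin 2020 (unforced, `ν = 1`), with the
  axisymmetry hypothesis in the slice form `∀ t ∈ ]-R², 0[` used by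
  `Seregin2020_axisymmetricSingularPoint_typeII` and `SereginSverak2009.IsAxisymmetricLocalSolution`.

Only the symmetry of the velocity is used (not of the pressure or the force), and only at the
times met by `Q`; regularity being a local property of `u`, no symmetry of the region is needed.
Not here: the higher regularity off `S` ("any spatial derivative of `v` is Hölder continuous"),
which is the named fact `NSBoundedHigherRegularity` (`NSBoundedHigherRegularity.lean`) applied at
regular points.

## Mathlib / tree search

Tree (all used): `ckn_partial_regularity_holds` (CKN Thm. B), `isCKNForceOn_zero`,
`IsParabolicNull.hausdorffMeasure_eq_zero_holds` (`𝒫¹`-null ⇒ `ℋ¹`-null), `rotZLIE`,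
`IsAxisymmetric.rotZ_apply_rotZ_neg`, `norm_rotZ`, `cylRadius_sq`, `rotZ_add`, `rotZ_zero`,
`exists_parabolicCylinderCentered_subset`, `mem_parabolicCylinderCentered_self`,
`SereginSverak2009.parCyl`. Mathlib: `LipschitzWith.hausdorffMeasure_image_le`,
`MeasureTheory.hausdorffMeasure_real`, `intermediate_value_Ioo`, `Real.sin_pos_of_pos_of_lt_pi`,
`MeasurePreserving.restrict_preimage_emb`. `lean search 'IsRegularPoint.*rotZ|singularSet.*axis'`:
nothing of this kind in tree (the off-axis regularity of `AxisymmetricTypeIOffAxis.lean` is for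
CLASSICAL solutions, by rotation packing of the dissipation and `seregin2014_thm14`).

## References

* G. Seregin, Anal. Math. Phys. 10 (2020), Paper 46 = arXiv:2006.04140, §2, proof of Thm. 2.1
  (arXiv p. 5 and p. 7). [`Seregin2020`]
* G. Seregin, V. Šverák, Comm. PDE 34 (2009) 171–201 = arXiv:0804.1803, §3, p. 9.
  [`SereginSverak2009`]
* L. Caffarelli, R. Kohn, L. Nirenberg, Comm. Pure Appl. Math. 35 (1982), Theorem B and §6.
  [`CKN1982`]
-/

noncomputable section

open MeasureTheory Set Function Filter Metric TopologicalSpace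
open _root_.Topology
open scoped ENNReal NNReal

namespace Literature.Analysis.FluidPDE

/-! ### Rotation covariance of regular points -/

/-- The orbit map `θ ↦ R_θ x` of a point under the rotations about the axis is continuous.
[folklore] -/
theorem continuous_rotZ_angle (x : EuclideanSpace ℝ (Fin 3)) :
    Continuous fun θ : ℝ => rotZ θ x := by
  unfold rotZ
  refine (PiLp.continuous_toLp 2 _).comp ?_
  refine continuous_pi fun i => ?_
  have hc : Continuous fun θ : ℝ => Real.cos θ := Real.continuous_cos
  have hs : Continuous fun θ : ℝ => Real.sin θ := Real.continuous_sin
  fin_cases i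
  · exact ((hc.mul (continuous_const (y := x 0))).sub
      (hs.mul (continuous_const (y := x 1)))).congr fun θ => by simp
  · exact ((hs.mul (continuous_const (y := x 0))).add
      (hc.mul (continuous_const (y := x 1)))).congr fun θ => by simp
  · exact (continuous_const (y := x 2)).congr fun θ => by simp

/-- **Regular points rotate with the flow's symmetry.** If the slices `u t` are axisymmetric for
`t` in a neighbourhood `]t₀ - ε, t₀ + ε[` of `t₀` and `(t₀, x₀)` is a regular point of `u`
(`u ∈ L^∞(Q*_r(t₀, x₀))` for some `r > 0`), then so is `(t₀, R_θ x₀)` for every angle `θ`: the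
space–time rotation `Φ(t, x) = (t, R_{-θ} x)` is a measure-preserving bijection with
`Φ(Q*_r(t₀, R_θ x₀)) = Q*_r(t₀, x₀)`, and `|u(t, x)| = |R_θ u(t, R_{-θ} x)| = |u(Φ(t, x))|` at
symmetric times, so the essential bound of `u` near `(t₀, x₀)` is an essential bound near
`(t₀, R_θ x₀)` (Seregin–Šverák 2009, §3, arXiv p. 9; Caffarelli–Kohn–Nirenberg 1982, §6 for the
notion of regular point). [cite: SereginSverak2009, §3 (arXiv p. 9)] -/
theorem IsRegularPoint.rotZ_of_isAxisymmetric
    {u : ℝ → EuclideanSpace ℝ (Fin 3) → EuclideanSpace ℝ (Fin 3)} {t₀ ε : ℝ}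
    {x₀ : EuclideanSpace ℝ (Fin 3)} (hε : 0 < ε)
    (hax : ∀ t ∈ Ioo (t₀ - ε) (t₀ + ε), IsAxisymmetric (u t))
    (h : IsRegularPoint u (t₀, x₀)) (θ : ℝ) : IsRegularPoint u (t₀, rotZ θ x₀) := by
  obtain ⟨r, hr, hb⟩ := h
  set S : Set (ℝ × EuclideanSpace ℝ (Fin 3)) :=
    parabolicCylinderCentered r ((t₀, x₀) : ℝ × EuclideanSpace ℝ (Fin 3)) with hS
  set M : ℝ≥0∞ := eLpNorm (uncurry u) ∞ (volume.restrict S) with hM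
  have hMae : ∀ᵐ w ∂(volume.restrict S), ‖uncurry u w‖ₑ ≤ M := by
    rw [hM, eLpNorm_exponent_top]
    exact ae_le_eLpNormEssSup
  -- the space–time rotation `Φ(t, x) = (t, R_{-θ} x)`
  set Φ : ℝ × EuclideanSpace ℝ (Fin 3) → ℝ × EuclideanSpace ℝ (Fin 3) :=
    Prod.map id (rotZLIE (-θ)) with hΦdef
  have hΦ : ∀ w, Φ w = (w.1, rotZ (-θ) w.2) := fun w => rfl
  have hmp : MeasurePreserving Φ (volume : Measure (ℝ × EuclideanSpace ℝ (Fin 3))) volume :=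
    (MeasurePreserving.id (volume : Measure ℝ)).prod (rotZLIE (-θ)).measurePreserving
  have hemb : MeasurableEmbedding Φ :=
    MeasurableEmbedding.id.prodMap (rotZLIE (-θ)).toHomeomorph.measurableEmbedding
  have hΦc : Continuous Φ := continuous_id.prodMap (rotZLIE (-θ)).continuous
  have hres : MeasurePreserving Φ (volume.restrict (Φ ⁻¹' S)) (volume.restrict S) :=
    hmp.restrict_preimage_emb hemb S
  have htr : ∀ᵐ w ∂(volume.restrict (Φ ⁻¹' S)), ‖uncurry u (Φ w)‖ₑ ≤ M :=
    hres.quasiMeasurePreserving.ae hMae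
  -- a centred cylinder about the rotated point inside `Φ⁻¹ S` and the strip of symmetric times
  set T : Set (ℝ × EuclideanSpace ℝ (Fin 3)) :=
    Ioo (t₀ - ε) (t₀ + ε) ×ˢ (univ : Set (EuclideanSpace ℝ (Fin 3))) with hT
  have hopen : IsOpen (Φ ⁻¹' S ∩ T) :=
    ((isOpen_parabolicCylinderCentered _ _).preimage hΦc).inter (isOpen_Ioo.prod isOpen_univ)
  have hzmem : ((t₀, rotZ θ x₀) : ℝ × EuclideanSpace ℝ (Fin 3)) ∈ Φ ⁻¹' S ∩ T := by
    refine ⟨?_, ⟨⟨by linarith, by linarith⟩, mem_univ _⟩⟩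
    show Φ (t₀, rotZ θ x₀) ∈ S
    rw [hΦ]
    dsimp only
    rw [← rotZ_add, neg_add_cancel, rotZ_zero]
    exact mem_parabolicCylinderCentered_self hr _
  obtain ⟨ρ, hρ, -, hsub⟩ := exists_parabolicCylinderCentered_subset hopen hzmem
  refine ⟨ρ, hρ, ?_⟩
  have hbM : M < ∞ := hb
  rw [eLpNorm_exponent_top]
  refine (eLpNormEssSup_le_of_ae_enorm_bound (C := M) ?_).trans_lt hbM
  have hsub1 : parabolicCylinderCentered ρ ((t₀, rotZ θ x₀) : ℝ × EuclideanSpace ℝ (Fin 3)) ⊆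
      Φ ⁻¹' S := fun w hw => (hsub hw).1
  filter_upwards [ae_restrict_of_ae_restrict_of_subset hsub1 htr,
    ae_restrict_mem (isOpen_parabolicCylinderCentered ρ
      ((t₀, rotZ θ x₀) : ℝ × EuclideanSpace ℝ (Fin 3))).measurableSet] with w hw hwmem
  have hwT : w.1 ∈ Ioo (t₀ - ε) (t₀ + ε) := (hsub hwmem).2.1
  calc ‖uncurry u w‖ₑ = ‖rotZ θ (u w.1 (rotZ (-θ) w.2))‖ₑ := by
        rw [(hax w.1 hwT).rotZ_apply_rotZ_neg θ w.2]
        rfl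
    _ = ‖u w.1 (rotZ (-θ) w.2)‖ₑ := by
        rw [← ofReal_norm, ← ofReal_norm, norm_rotZ]
    _ = ‖uncurry u (Φ w)‖ₑ := by rw [hΦ]; rfl
    _ ≤ M := hw

/-! ### Orbit arcs off the axis have positive length -/

/-- `|a d - b c| ≤ √(a² + b²) √(c² + d²)` (Cauchy–Schwarz in the plane:
`(a² + b²)(c² + d²) - (ad - bc)² = (ac + bd)²`). [folklore] -/
theorem abs_mul_sub_mul_le_sqrt_mul_sqrt (a b c d : ℝ) :
    |a * d - b * c| ≤ Real.sqrt (a ^ 2 + b ^ 2) * Real.sqrt (c ^ 2 + d ^ 2) := by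
  rw [← Real.sqrt_mul (by positivity), ← Real.sqrt_sq_eq_abs]
  refine Real.sqrt_le_sqrt ?_
  have e : (a ^ 2 + b ^ 2) * (c ^ 2 + d ^ 2) - (a * d - b * c) ^ 2 = (a * c + b * d) ^ 2 := by
    ring
  nlinarith [sq_nonneg (a * c + b * d), e]

/-- The horizontal part of the Euclidean norm: `√(v₀² + v₁²) ≤ ‖v‖` on `ℝ³`. [folklore] -/
theorem sqrt_sq_add_sq_le_norm (v : EuclideanSpace ℝ (Fin 3)) :
    Real.sqrt (v 0 ^ 2 + v 1 ^ 2) ≤ ‖v‖ := by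
  rw [EuclideanSpace.norm_eq, Fin.sum_univ_three]
  simp only [Real.norm_eq_abs, sq_abs]
  exact Real.sqrt_le_sqrt (by nlinarith [sq_nonneg (v 2)])

/-- **An orbit arc off the axis has positive one-dimensional Hausdorff measure.** For `x₀` with
`|x₀'| = ρ ≠ 0`, every time `t₀` and every `δ > 0`, the arc `{(t₀, R_θ x₀) : -δ < θ < δ} ⊆ ℝ × ℝ³`
has `ℋ¹ > 0`: the functional `f(t, x) = (x₀₀ x₁ - x₀₁ x₀)/ρ` is `1`-Lipschitz for the (sup)
product metric and takes the value `ρ sin θ` at `(t₀, R_θ x₀)`, so `f` maps the arc onto a set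
containing the interval `]-ρ sin δ', ρ sin δ'[`, `δ' = min(δ, π/2)`, of Lebesgue (= `ℋ¹`)
measure `2ρ sin δ' > 0`, while Lipschitz maps do not increase `ℋ¹`. [folklore] -/
theorem hausdorffMeasure_rotZ_arc_pos {x₀ : EuclideanSpace ℝ (Fin 3)} (hx : cylRadius x₀ ≠ 0)
    (t₀ : ℝ) {δ : ℝ} (hδ : 0 < δ) :
    0 < μH[1] ((fun θ : ℝ => ((t₀, rotZ θ x₀) : ℝ × EuclideanSpace ℝ (Fin 3))) '' Ioo (-δ) δ) := by
  set ρ : ℝ := cylRadius x₀ with hρdef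
  have hρ : 0 < ρ := lt_of_le_of_ne (cylRadius_nonneg x₀) (Ne.symm hx)
  have hρsq : ρ ^ 2 = x₀ 0 ^ 2 + x₀ 1 ^ 2 := cylRadius_sq x₀
  set A : Set (ℝ × EuclideanSpace ℝ (Fin 3)) :=
    (fun θ : ℝ => ((t₀, rotZ θ x₀) : ℝ × EuclideanSpace ℝ (Fin 3))) '' Ioo (-δ) δ with hA
  -- the `1`-Lipschitz functional
  set f : ℝ × EuclideanSpace ℝ (Fin 3) → ℝ := fun z => (x₀ 0 * z.2 1 - x₀ 1 * z.2 0) / ρ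
    with hfdef
  have hf : LipschitzWith 1 f := by
    refine LipschitzWith.of_dist_le_mul fun z w => ?_
    rw [NNReal.coe_one, one_mul, Real.dist_eq]
    have hsub : f z - f w = (x₀ 0 * (z.2 1 - w.2 1) - x₀ 1 * (z.2 0 - w.2 0)) / ρ := by
      simp only [hfdef]
      field_simp
      ring
    rw [hsub, abs_div, abs_of_pos hρ, div_le_iff₀ hρ]
    calc |x₀ 0 * (z.2 1 - w.2 1) - x₀ 1 * (z.2 0 - w.2 0)|
        ≤ Real.sqrt (x₀ 0 ^ 2 + x₀ 1 ^ 2) *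
            Real.sqrt ((z.2 0 - w.2 0) ^ 2 + (z.2 1 - w.2 1) ^ 2) :=
          abs_mul_sub_mul_le_sqrt_mul_sqrt _ _ _ _
      _ = ρ * Real.sqrt ((z.2 - w.2) 0 ^ 2 + (z.2 - w.2) 1 ^ 2) := by
          rw [hρdef, cylRadius, PiLp.sub_apply, PiLp.sub_apply]
      _ ≤ ρ * ‖z.2 - w.2‖ := mul_le_mul_of_nonneg_left (sqrt_sq_add_sq_le_norm _) hρ.le
      _ = ρ * dist z.2 w.2 := by rw [dist_eq_norm]
      _ ≤ ρ * dist z w :=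
          mul_le_mul_of_nonneg_left (by rw [Prod.dist_eq]; exact le_max_right _ _) hρ.le
      _ = dist z w * ρ := mul_comm _ _
  -- its values on the arc
  have hval : ∀ θ : ℝ, f (t₀, rotZ θ x₀) = ρ * Real.sin θ := by
    intro θ
    simp only [hfdef, rotZ_apply_zero, rotZ_apply_one]
    rw [div_eq_iff hρ.ne']
    linear_combination Real.sin θ * hρsq.symm
  have himage : f '' A = (fun θ : ℝ => ρ * Real.sin θ) '' Ioo (-δ) δ := by
    rw [hA, image_image]
    exact image_congr fun θ _ => hval θ
  -- an interval inside the image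
  set δ' : ℝ := min δ (Real.pi / 2) with hδ'
  have hδ'pos : 0 < δ' := lt_min hδ (by positivity)
  have hδ'le : δ' ≤ δ := min_le_left _ _
  have hδ'pi : δ' < Real.pi := (min_le_right _ _).trans_lt (by linarith [Real.pi_pos])
  have hsin : 0 < Real.sin δ' := Real.sin_pos_of_pos_of_lt_pi hδ'pos hδ'pi
  have hcont : ContinuousOn (fun θ : ℝ => ρ * Real.sin θ) (Icc (-δ') δ') :=
    (continuous_const.mul Real.continuous_sin).continuousOn
  have hIVT : Ioo (ρ * Real.sin (-δ')) (ρ * Real.sin δ') ⊆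
      (fun θ : ℝ => ρ * Real.sin θ) '' Ioo (-δ') δ' :=
    intermediate_value_Ioo (by linarith) hcont
  have hsubset : Ioo (ρ * Real.sin (-δ')) (ρ * Real.sin δ') ⊆ f '' A := by
    rw [himage]
    exact hIVT.trans (image_mono (Ioo_subset_Ioo (by linarith) hδ'le))
  -- measures
  have hpos : 0 < μH[1] (Ioo (ρ * Real.sin (-δ')) (ρ * Real.sin δ')) := by
    rw [hausdorffMeasure_real, Real.volume_Ioo, Real.sin_neg]
    exact ENNReal.ofReal_pos.2 (by nlinarith)
  have hle : μH[1] (f '' A) ≤ μH[1] A := by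
    have := hf.hausdorffMeasure_image_le zero_le_one A
    simpa only [ENNReal.coe_one, ENNReal.one_rpow, one_mul] using this
  exact (hpos.trans_le (measure_mono hsubset)).trans_le hle

/-! ### The singular set lies on the axis -/

section OnAxis

variable {Q : Opens (ℝ × EuclideanSpace ℝ (Fin 3))} {ν : ℝ}
  {f u : ℝ → EuclideanSpace ℝ (Fin 3) → EuclideanSpace ℝ (Fin 3)}
  {p : ℝ → EuclideanSpace ℝ (Fin 3) → ℝ}

/-- **Singular points of axisymmetric suitable weak solutions lie on the axis of symmetry**
(Seregin 2020, proof of Thm. 2.1, arXiv p. 5: "`x' = 0` for any `z = (x, t) ∈ S`";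
Seregin–Šverák 2009, §3, arXiv p. 9: "all singular points must belong to the axis of symmetry",
"well-known due to Caffarelli–Kohn–Nirenberg"). Let `(u, p)` be a suitable weak solution of the
Navier–Stokes system with viscosity `ν > 0` and a CKN force `f` on the open region `Q ⊆ ℝ × ℝ³`,
and let the slice `u t` be axisymmetric about the `x₃`-axis for every time `t` met by `Q`. Then
every point of the singular set `S = {z ∈ Q : u ∉ L^∞ near z}` lies on the axis, `|x'| = 0`.
Proof: `𝒫¹(S) = 0` (CKN, Thm. B; `ckn_partial_regularity_holds`), hence `ℋ¹(S) = 0`; were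
`z₀ = (t₀, x₀) ∈ S` with `x₀' ≠ 0`, the arc `{(t₀, R_θ x₀) : |θ| < δ}` would lie in `Q` for small
`δ` (`Q` open) and consist of singular points (`IsRegularPoint.rotZ_of_isAxisymmetric` with the
angle `-θ`), yet it has positive `ℋ¹`-measure (`hausdorffMeasure_rotZ_arc_pos`).
[cite: Seregin2020, §2, proof of Thm. 2.1 (arXiv p. 5)] -/
theorem cylRadius_eq_zero_of_mem_singularSet (hν : 0 < ν) (h : IsSuitableWeakSolutionOn Q ν f u p)
    (hf : IsCKNForceOn Q f)
    (hax : ∀ z ∈ (Q : Set (ℝ × EuclideanSpace ℝ (Fin 3))), IsAxisymmetric (u z.1))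
    {z : ℝ × EuclideanSpace ℝ (Fin 3)}
    (hz : z ∈ singularSet u (Q : Set (ℝ × EuclideanSpace ℝ (Fin 3)))) : cylRadius z.2 = 0 := by
  by_contra hρ
  obtain ⟨t₀, x₀⟩ := z
  obtain ⟨hzQ, hzs⟩ := hz
  -- symmetric times around `t₀`
  obtain ⟨ε, hε, hεQ⟩ := Metric.isOpen_iff.1 Q.isOpen (t₀, x₀) hzQ
  have hax' : ∀ t ∈ Ioo (t₀ - ε) (t₀ + ε), IsAxisymmetric (u t) := by
    intro t ht
    have hmem : ((t, x₀) : ℝ × EuclideanSpace ℝ (Fin 3)) ∈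
        (Q : Set (ℝ × EuclideanSpace ℝ (Fin 3))) := by
      refine hεQ ?_
      rw [mem_ball, Prod.dist_eq, dist_self, Real.dist_eq]
      exact max_lt (abs_sub_lt_iff.2 ⟨by linarith [ht.2], by linarith [ht.1]⟩) hε
    exact hax _ hmem
  -- admissible angles: the orbit stays in `Q` for `|θ| < δ`
  set γ : ℝ → ℝ × EuclideanSpace ℝ (Fin 3) :=
    fun θ => ((t₀, rotZ θ x₀) : ℝ × EuclideanSpace ℝ (Fin 3)) with hγ
  have hcont : Continuous γ := continuous_const.prodMk (continuous_rotZ_angle x₀)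
  have hpre : IsOpen (γ ⁻¹' (Q : Set (ℝ × EuclideanSpace ℝ (Fin 3)))) := Q.isOpen.preimage hcont
  have h0 : (0 : ℝ) ∈ γ ⁻¹' (Q : Set (ℝ × EuclideanSpace ℝ (Fin 3))) := by
    show ((t₀, rotZ 0 x₀) : ℝ × EuclideanSpace ℝ (Fin 3)) ∈
      (Q : Set (ℝ × EuclideanSpace ℝ (Fin 3)))
    rw [rotZ_zero]
    exact hzQ
  obtain ⟨δ, hδ, hδsub⟩ := Metric.isOpen_iff.1 hpre 0 h0
  -- the arc consists of singular points of `u` in `Q`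
  have hA : γ '' Ioo (-δ) δ ⊆ singularSet u (Q : Set (ℝ × EuclideanSpace ℝ (Fin 3))) := by
    rintro _ ⟨θ, hθ, rfl⟩
    have hθQ : γ θ ∈ (Q : Set (ℝ × EuclideanSpace ℝ (Fin 3))) := by
      refine hδsub ?_
      rw [mem_ball, dist_zero_right, Real.norm_eq_abs, abs_lt]
      exact ⟨hθ.1, hθ.2⟩
    refine ⟨hθQ, fun hreg => hzs ?_⟩
    have key := hreg.rotZ_of_isAxisymmetric hε hax' (-θ)
    rwa [← rotZ_add, neg_add_cancel, rotZ_zero] at key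
  -- `ℋ¹(S) = 0` (CKN) against `ℋ¹(arc) > 0`
  have hnull : μH[1] (singularSet u (Q : Set (ℝ × EuclideanSpace ℝ (Fin 3)))) = 0 :=
    IsParabolicNull.hausdorffMeasure_eq_zero_holds one_pos (ckn_partial_regularity_holds Q hν h hf)
  exact (hausdorffMeasure_rotZ_arc_pos hρ t₀ hδ).ne' (measure_mono_null hA hnull)

/-- **Off the axis, every point is regular** (contrapositive form of
`cylRadius_eq_zero_of_mem_singularSet`; Seregin–Zajaczkowski 2007, §3: "by
Caffarelli–Kohn–Nirenberg type results, all points `y' ≠ 0` are regular"): under the same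
hypotheses, `u` is essentially bounded near every `z ∈ Q` with `|x'| ≠ 0`.
[cite: SereginSverak2009, §3 (arXiv p. 9)] -/
theorem isRegularPoint_of_cylRadius_ne_zero (hν : 0 < ν) (h : IsSuitableWeakSolutionOn Q ν f u p)
    (hf : IsCKNForceOn Q f)
    (hax : ∀ z ∈ (Q : Set (ℝ × EuclideanSpace ℝ (Fin 3))), IsAxisymmetric (u z.1))
    {z : ℝ × EuclideanSpace ℝ (Fin 3)} (hzQ : z ∈ (Q : Set (ℝ × EuclideanSpace ℝ (Fin 3))))
    (hz : cylRadius z.2 ≠ 0) : IsRegularPoint u z := by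
  by_contra hreg
  exact hz (cylRadius_eq_zero_of_mem_singularSet hν h hf hax ⟨hzQ, hreg⟩)

/-- **The singular set is contained in the axis** (set form of
`cylRadius_eq_zero_of_mem_singularSet`): `S ⊆ Q ∩ {x' = 0}`.
[cite: Seregin2020, §2, proof of Thm. 2.1 (arXiv p. 5)] -/
theorem singularSet_subset_axis (hν : 0 < ν) (h : IsSuitableWeakSolutionOn Q ν f u p)
    (hf : IsCKNForceOn Q f)
    (hax : ∀ z ∈ (Q : Set (ℝ × EuclideanSpace ℝ (Fin 3))), IsAxisymmetric (u z.1)) :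
    singularSet u (Q : Set (ℝ × EuclideanSpace ℝ (Fin 3))) ⊆
      (Q : Set (ℝ × EuclideanSpace ℝ (Fin 3))) ∩ {z | cylRadius z.2 = 0} :=
  fun _ hz => ⟨hz.1, cylRadius_eq_zero_of_mem_singularSet hν h hf hax hz⟩

end OnAxis

/-! ### The cylinders of Seregin–Šverák 2009 and Seregin 2020 -/

section Cylinders

variable {R : ℝ} {u : ℝ → EuclideanSpace ℝ (Fin 3) → EuclideanSpace ℝ (Fin 3)}
  {p : ℝ → EuclideanSpace ℝ (Fin 3) → ℝ}

/-- **Singular points of an axisymmetric suitable weak solution in `Q(0, R) = 𝒞(R) × ]-R², 0[`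
lie on the axis** — the unforced case `ν = 1` on the cylinders of Seregin–Šverák 2009, §3 /
Seregin 2020, §2, with the symmetry hypothesis in slice form (`u t` axisymmetric for
`-R² < t < 0`, as in `SereginSverak2009.IsAxisymmetricLocalSolution` and in
`Seregin2020_axisymmetricSingularPoint_typeII`, where `R = 1`).
[cite: Seregin2020, §2, proof of Thm. 2.1 (arXiv p. 5)] -/
theorem SereginSverak2009.cylRadius_eq_zero_of_mem_singularSet_parCyl
    (h : IsSuitableWeakSolutionOn (SereginSverak2009.parCylOpens 0 R) 1 0 u p)
    (hax : ∀ t ∈ Ioo (-R ^ 2) 0, IsAxisymmetric (u t)) {z : ℝ × EuclideanSpace ℝ (Fin 3)}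
    (hz : z ∈ singularSet u (SereginSverak2009.parCyl 0 R)) : cylRadius z.2 = 0 := by
  have hax' : ∀ w ∈ ((SereginSverak2009.parCylOpens 0 R : Opens (ℝ × EuclideanSpace ℝ (Fin 3))) :
      Set (ℝ × EuclideanSpace ℝ (Fin 3))), IsAxisymmetric (u w.1) := by
    intro w hw
    rw [SereginSverak2009.coe_parCylOpens, SereginSverak2009.mem_parCyl_zero] at hw
    exact hax _ hw.1
  have hz' : z ∈ singularSet u ((SereginSverak2009.parCylOpens 0 R :
      Opens (ℝ × EuclideanSpace ℝ (Fin 3))) : Set (ℝ × EuclideanSpace ℝ (Fin 3))) := by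
    rwa [SereginSverak2009.coe_parCylOpens]
  exact cylRadius_eq_zero_of_mem_singularSet one_pos h (isCKNForceOn_zero _) hax' hz'

/-- **Off-axis points of `Q(0, R)` are regular** for an axisymmetric suitable weak solution of the
unforced system (`ν = 1`) in `Q(0, R)` (Seregin–Šverák 2009, §3, arXiv p. 9).
[cite: SereginSverak2009, §3 (arXiv p. 9)] -/
theorem SereginSverak2009.isRegularPoint_of_cylRadius_ne_zero_parCyl
    (h : IsSuitableWeakSolutionOn (SereginSverak2009.parCylOpens 0 R) 1 0 u p)
    (hax : ∀ t ∈ Ioo (-R ^ 2) 0, IsAxisymmetric (u t)) {z : ℝ × EuclideanSpace ℝ (Fin 3)}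
    (hzQ : z ∈ SereginSverak2009.parCyl 0 R) (hz : cylRadius z.2 ≠ 0) : IsRegularPoint u z := by
  by_contra hreg
  exact hz (SereginSverak2009.cylRadius_eq_zero_of_mem_singularSet_parCyl h hax ⟨hzQ, hreg⟩)

end Cylinders

end Literature.Analysis.FluidPDE

end
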